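import Literature.NumberTheory.GaloisRepresentations.ContinuousShapiroLiftCores
import Literature.NumberTheory.GaloisRepresentations.ContinuousCupProductConj
import HarnessLib

/-!
# The Shapiro lift along a continuous homomorphism `θ : D → G` with ONE ORBIT:
# `res_θ ∘ Sh^G_N = Sh^D_{θ⁻¹N} ∘ res_θ` and the restricted fibre-sum pairing, companion of
# `ContinuousShapiroLift.lean` / `…Cores.lean` / `…Pairing.lean` / `…Functor.lean`

Generic continuous group cohomology (no number theory); namespace `Literature.NumberTheory.GaloisRepresentations`.
Definitions with bodies and theorems; NO named fact, no `sorry`, no instance, no notation.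

Setting: `θ : D →ₜ* G` a continuous homomorphism of topological groups, `N ≤ G` and `U ≤ D` open subgroups with
`θ(U) ⊆ N` (`hUN`), the induced map of coset spaces `θ̄ : D ⧸ U → G ⧸ N` (`quotientPull`), coefficient modules
`X : TopRep R G`, `X' : TopRep R D` with a morphism `α : X|_θ ⟶ X'`.  The typical instance is a decomposition group
`θ : Γ_v → Γ_K`, `N = Γ_L` for a finite Galois `L/K` and `U = θ⁻¹(N) = Γ_{L_w}`, with ONE ORBIT: `θ̄` bijective, i.e.
`θ(D)·N = G` (one place `w` of `L` above `v`, e.g. total ramification) and `U = θ⁻¹(N)`.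

* §1 `quotientPull`, its equivariance `θ̄(d • z) = θ(d) • θ̄(z)`, injectivity (`U = θ⁻¹ N`) and surjectivity
  (`θ(D)·N = G`); the coefficient morphism **`coindFinPull : Maps(G ⧸ N, X)|_θ ⟶ Maps(D ⧸ U, X')`**, `φ ↦ α ∘ φ ∘ θ̄`,
  and `subgroupRepPull : (X|_N)|_{θ_U} ⟶ X'|_U` for the restriction `θ_U : U → N` of `θ`.
* §2 **The Shapiro lift commutes with the pull-back along `θ`, ON THE NOSE for adapted representatives**
  (`pullback_coindFinPull_shapiroCocycle`: if `s(θ̄ z) = θ(t z)` then `coindFinPull ∘ Sh^G_{N,s}(f) ∘ θ = Sh^D_{U,t}(α ∘ f ∘ θ_U)`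
  — the Schreier elements correspond under `θ`), the existence of adapted representatives when `θ̄` is bijective
  (`exists_pull_adapted_reps`), and ON CLASSES for arbitrary representatives:
  **`H¹(θ, coindFinPull) (Sh^G_N c) = Sh^D_U (H¹(θ_U, α) c)`** (`map_coindFinPull_shapiroLift`).
* §3 Pairings: for compatible pairings `γ⟨x, y⟩ = ⟨α x, β y⟩'` the FIBRE-SUM pairings correspond under `coindFinPull`
  when `θ̄` is bijective (`ContPairing.coindFin_toLin_pull`: `γ(Σ_{G⧸N} ⟨φ y, ψ y⟩) = Σ_{D⧸U} ⟨α φ(θ̄ z), β ψ(θ̄ z)⟩'`,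
  reindexing), hence **`H²(θ, γ)(a ∪_{ΣP} b) = H¹(θ, coindFinPull) a ∪_{ΣP'} H¹(θ, coindFinPull) b`**
  (`ContPairing.map_cupProduct_coindFin_pull`, by the tree's `cupProduct_mapPair`).

Use (BSD wall, K3 (PT-orth) «S2-B2», lead tp2-p2x g5): with `G = Γ_ℚ`, `N = Γ_n` (a cyclotomic layer), `D = Γ_v`
(`v ∣ p`, one orbit by total ramification), the localisation at `v` of the GLOBAL Shapiro cup class
`Sh a ∪_{Σe} Sh b ∈ H²(Γ_ℚ, μ_N)` is the LAYER cup class `Sh(loc a) ∪_{Σe_v} Sh(loc b) ∈ H²(Γ_v, μ_N|)` whose invariant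
is the layer pairing `layerPairingMod` of `Theorems/…LayerPairingModDefs.lean`.

## References

* J. Neukirch, A. Schmidt, K. Wingberg, *Cohomology of Number Fields*, 2nd ed. (2008), I §5 (compatible pairs,
  Prop. 1.5.3 naturality of cup products), I §6 Prop. (1.6.4) (Shapiro's lemma) and (1.6.5) (its functoriality).
  [NeukirchSchmidtWingberg2008]
* J.-P. Serre, *Local Fields* (1979), VII §5–§6. [SerreLocalFields1979]
-/

noncomputable section

open CategoryTheory

open scoped Classical

universe u v

namespace Literature.NumberTheory.GaloisRepresentations

open _root_.TopRep
open Literature.NumberTheory.EllipticCurves (schreierElt schreierElt_mem schreierElt_coe)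

variable {R : Type u} [CommRing R] [TopologicalSpace R]
variable {G : Type v} [Group G] [TopologicalSpace G] [IsTopologicalGroup G]
variable {D : Type v} [Group D] [TopologicalSpace D] [IsTopologicalGroup D]

/-! ## §1 The map of coset spaces and the coefficient morphisms -/

section Quotient

variable (N : Subgroup G) (θ : D →ₜ* G) (U : Subgroup D) (hUN : ∀ d : D, d ∈ U → θ d ∈ N)

omit [IsTopologicalGroup G] [IsTopologicalGroup D] in
/-- **`θ̄ : D ⧸ U → G ⧸ N`**, `dU ↦ θ(d)N` (well defined as `θ(U) ⊆ N`). [cite: NeukirchSchmidtWingberg2008, I §6 (1.6.5)] -/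
def quotientPull : D ⧸ U → G ⧸ N :=
  Quotient.map' θ fun a b h => by
    rw [QuotientGroup.leftRel_apply] at h ⊢
    rw [← map_inv, ← map_mul]
    exact hUN _ h

omit [IsTopologicalGroup G] [IsTopologicalGroup D] in
/-- `θ̄(dU) = θ(d)N`. [cite: NeukirchSchmidtWingberg2008, I §6 (1.6.5)] -/
@[simp]
theorem quotientPull_mk (d : D) : quotientPull N θ U hUN (d : D ⧸ U) = ((θ d : G) : G ⧸ N) := rfl

omit [IsTopologicalGroup G] [IsTopologicalGroup D] in
/-- **`θ̄` is `θ`-equivariant**: `θ̄(d • z) = θ(d) • θ̄(z)`. [cite: NeukirchSchmidtWingberg2008, I §6 (1.6.5)] -/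
theorem quotientPull_smul (d : D) (z : D ⧸ U) :
    quotientPull N θ U hUN (d • z) = θ d • quotientPull N θ U hUN z := by
  induction z using QuotientGroup.induction_on with
  | H a => rw [MulAction.Quotient.smul_coe, quotientPull_mk, quotientPull_mk, MulAction.Quotient.smul_coe,
      smul_eq_mul, smul_eq_mul, map_mul]

omit [IsTopologicalGroup G] [IsTopologicalGroup D] in
/-- `θ̄` is injective when `U = θ⁻¹(N)`. [cite: NeukirchSchmidtWingberg2008, I §6 (1.6.5)] -/
theorem quotientPull_injective (hNU : ∀ d : D, θ d ∈ N → d ∈ U) :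
    Function.Injective (quotientPull N θ U hUN) := by
  intro z₁ z₂ h
  induction z₁ using QuotientGroup.induction_on with
  | H a =>
    induction z₂ using QuotientGroup.induction_on with
    | H b =>
      rw [quotientPull_mk, quotientPull_mk, QuotientGroup.eq, ← map_inv, ← map_mul] at h
      exact QuotientGroup.eq.mpr (hNU _ h)

omit [IsTopologicalGroup G] [IsTopologicalGroup D] in
/-- `θ̄` is surjective when `θ(D)·N = G` (ONE ORBIT of `D` on `G ⧸ N`). [cite: NeukirchSchmidtWingberg2008, I §6 (1.6.5)] -/
theorem quotientPull_surjective (hcov : ∀ g : G, ∃ d : D, (θ d)⁻¹ * g ∈ N) :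
    Function.Surjective (quotientPull N θ U hUN) := by
  intro y
  induction y using QuotientGroup.induction_on with
  | H g =>
    obtain ⟨d, hd⟩ := hcov g
    exact ⟨(d : D ⧸ U), by rw [quotientPull_mk]; exact QuotientGroup.eq.mpr hd⟩

end Quotient

section Pull

variable (X : TopRep.{v} R G) (N : Subgroup G) (θ : D →ₜ* G) {X' : TopRep.{v} R D}
  (α : TopRep.res (θ : D →* G) X ⟶ X') (U : Subgroup D) (hUN : ∀ d : D, d ∈ U → θ d ∈ N)

/-- **`coindFinPull : Maps(G ⧸ N, X)|_θ ⟶ Maps(D ⧸ U, X')`**, `φ ↦ α ∘ φ ∘ θ̄` — a morphism of topological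
representations of `D` (`θ̄` is `θ`-equivariant, `α` intertwines). [cite: NeukirchSchmidtWingberg2008, I §6 (1.6.5)] -/
def coindFinPull : TopRep.res (θ : D →* G) (coindFin X N) ⟶ coindFin X' U :=
  TopRep.ofHom
    { toContinuousLinearMap :=
        { toFun := fun φ => fun z => α.hom (φ (quotientPull N θ U hUN z))
          map_add' := fun φ ψ => funext fun z => by
            change α.hom (φ (quotientPull N θ U hUN z) + ψ (quotientPull N θ U hUN z)) = _
            rw [map_add]
            rfl
          map_smul' := fun r φ => funext fun z => by
            change α.hom (r • φ (quotientPull N θ U hUN z)) = _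
            rw [map_smul]
            rfl
          cont := continuous_pi fun z => α.hom.continuous.comp (continuous_apply _) }
      isIntertwining' := fun d => by
        ext φ z
        change α.hom ((coindFin X N).ρ (θ d) φ (quotientPull N θ U hUN z)) =
          X'.ρ d (α.hom (φ (quotientPull N θ U hUN (d⁻¹ • z))))
        rw [coindFin_ρ_apply, ← map_inv, ← quotientPull_smul]
        exact TopRep.hom_comm_apply α d _ }

omit [IsTopologicalGroup G] [IsTopologicalGroup D] in
/-- Values of `coindFinPull`: `(α ∘ φ ∘ θ̄)(z) = α(φ(θ̄ z))`. [cite: NeukirchSchmidtWingberg2008, I §6 (1.6.5)] -/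
@[simp]
theorem coindFinPull_apply (φ : coindFin X N) (z : D ⧸ U) :
    (coindFinPull X N θ α U hUN).hom φ z = α.hom (φ (quotientPull N θ U hUN z)) := rfl

variable (θU : U →ₜ* N) (hθU : ∀ u : U, ((θU u : N) : G) = θ (u : D))

/-- **`subgroupRepPull : (X|_N)|_{θ_U} ⟶ X'|_U`** for the restriction `θ_U : U → N` of `θ`: the map `α` (it intertwines
as `θ_U u = θ u` in `G`). [cite: NeukirchSchmidtWingberg2008, I §6 (1.6.5)] -/
def subgroupRepPull : TopRep.res (θU : U →* N) (subgroupRep X N) ⟶ subgroupRep X' U :=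
  TopRep.ofHom
    { toContinuousLinearMap := α.hom.toContinuousLinearMap
      isIntertwining' := fun u => by
        ext x
        change α.hom (X.ρ ((θU u : N) : G) x) = X'.ρ (u : D) (α.hom x)
        rw [hθU]
        exact TopRep.hom_comm_apply α (u : D) x }

omit [IsTopologicalGroup G] [IsTopologicalGroup D] in
/-- Values of `subgroupRepPull`. [cite: NeukirchSchmidtWingberg2008, I §6 (1.6.5)] -/
@[simp]
theorem subgroupRepPull_apply (x : X) : (subgroupRepPull X N θ α U θU hθU).hom x = α.hom x := rfl

/-! ## §2 The Shapiro lift commutes with the pull-back -/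

/-- **On the nose, for adapted representatives**: if `s(θ̄ z) = θ(t z)` for all `z ∈ D ⧸ U` then
`coindFinPull ∘ Sh^G_{N,s}(f) ∘ θ = Sh^D_{U,t}(α ∘ f ∘ θ_U)` — the Schreier elements `s(θd • θ̄z)⁻¹ θ(d) s(θ̄ z)` and
`θ(t(d • z)⁻¹ d t(z))` coincide. [cite: NeukirchSchmidtWingberg2008, I §6 Prop. (1.6.4), (1.6.5)] -/
theorem pullback_coindFinPull_shapiroCocycle (hN : IsOpen (N : Set G)) (hU : IsOpen (U : Set D))
    {s : G ⧸ N → G} (hs : ∀ y : G ⧸ N, (s y : G ⧸ N) = y) {t : D ⧸ U → D} (ht : ∀ z : D ⧸ U, (t z : D ⧸ U) = z)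
    (hst : ∀ z : D ⧸ U, s (quotientPull N θ U hUN z) = θ (t z)) (f : contOneCocycles (subgroupRep X N)) :
    contOneCocycles.pullback θ (coindFinPull X N θ α U hUN) (shapiroCocycle X N hN hs f) =
      shapiroCocycle X' U hU ht (contOneCocycles.pullback θU (subgroupRepPull X N θ α U θU hθU) f) := by
  apply Subtype.ext
  ext d
  refine funext fun z => ?_
  rw [contOneCocycles.pullback_apply, coindFinPull_apply, shapiroCocycle_apply, shapiroCocycle_apply,
    contOneCocycles.pullback_apply, subgroupRepPull_apply]
  have hel : schreierElt N hs (θ d) ((θ d)⁻¹ • quotientPull N θ U hUN z) = θU (schreierElt U ht d (d⁻¹ • z)) := by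
    apply Subtype.ext
    rw [hθU, schreierElt_coe, schreierElt_coe, smul_inv_smul, smul_inv_smul, ← map_inv, ← quotientPull_smul,
      hst, hst, map_mul, map_mul, map_inv]
  rw [hel, hst]
  exact TopRep.hom_comm_apply α (t z) _

omit [IsTopologicalGroup G] [IsTopologicalGroup D] in
/-- **Adapted representatives exist** when `θ̄` is bijective: for representatives `t` of `D ⧸ U` with `t(1·U) = 1`
there are representatives `s` of `G ⧸ N` with `s(1·N) = 1` and `s(θ̄ z) = θ(t z)` (`s := θ ∘ t ∘ θ̄⁻¹`).
[cite: NeukirchSchmidtWingberg2008, I §6 (1.6.5)] -/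
theorem exists_pull_adapted_reps (hbij : Function.Bijective (quotientPull N θ U hUN)) {t : D ⧸ U → D}
    (ht : ∀ z : D ⧸ U, (t z : D ⧸ U) = z) (ht1 : t ((1 : D) : D ⧸ U) = 1) :
    ∃ s : G ⧸ N → G, (∀ y : G ⧸ N, (s y : G ⧸ N) = y) ∧ s ((1 : G) : G ⧸ N) = 1 ∧
      ∀ z : D ⧸ U, s (quotientPull N θ U hUN z) = θ (t z) := by
  set e := Equiv.ofBijective _ hbij with he
  refine ⟨fun y => θ (t (e.symm y)), fun y => ?_, ?_, fun z => ?_⟩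
  · change ((θ (t (e.symm y)) : G) : G ⧸ N) = y
    rw [← quotientPull_mk N θ U hUN, ht]
    exact e.apply_symm_apply y
  · have h1 : e.symm ((1 : G) : G ⧸ N) = ((1 : D) : D ⧸ U) := by
      rw [Equiv.symm_apply_eq, he, Equiv.ofBijective_apply, quotientPull_mk, map_one]
    change θ (t (e.symm ((1 : G) : G ⧸ N))) = 1
    rw [h1, ht1, map_one]
  · change θ (t (e.symm (e z))) = θ (t z)
    rw [e.symm_apply_apply]

/-- **`H¹(θ, coindFinPull) ∘ Sh^G_N = Sh^D_U ∘ H¹(θ_U, α)` on classes**, for ANY representatives on both sides, when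
`θ̄ : D ⧸ U → G ⧸ N` is bijective (one orbit and `U = θ⁻¹N`): the Shapiro isomorphism is functorial for the compatible
pair `(θ, α)`. [cite: NeukirchSchmidtWingberg2008, I §6 Prop. (1.6.4), (1.6.5)] -/
theorem map_coindFinPull_shapiroLift (hN : IsOpen (N : Set G)) (hU : IsOpen (U : Set D))
    {s : G ⧸ N → G} (hs : ∀ y : G ⧸ N, (s y : G ⧸ N) = y) (hs1 : s ((1 : G) : G ⧸ N) = 1)
    {t : D ⧸ U → D} (ht : ∀ z : D ⧸ U, (t z : D ⧸ U) = z) (ht1 : t ((1 : D) : D ⧸ U) = 1)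
    (hbij : Function.Bijective (quotientPull N θ U hUN)) (c : continuousCohomology 1 (subgroupRep X N)) :
    ContinuousCohomology.map θ (coindFinPull X N θ α U hUN) 1 (shapiroLift X N hN hs hs1 c) =
      shapiroLift X' U hU ht ht1 (ContinuousCohomology.map θU (subgroupRepPull X N θ α U θU hθU) 1 c) := by
  obtain ⟨s', hs', hs'1, hst⟩ := exists_pull_adapted_reps N θ U hUN hbij ht ht1
  rw [shapiroLift_eq_of_reps X N hN hs hs1 hs' hs'1]
  obtain ⟨f, rfl⟩ := oneCocycleClass_surjective _ c
  rw [shapiroLift_oneCocycleClass, map_oneCocycleClass, map_oneCocycleClass, shapiroLift_oneCocycleClass,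
    pullback_coindFinPull_shapiroCocycle X N θ α U hUN θU hθU hN hU hs' ht hst]

end Pull

/-! ## §3 The fibre-sum pairings and the cup product -/

namespace ContPairing

variable {X Y Z : TopRep.{v} R G} (P : ContPairing X Y Z) (N : Subgroup G) (θ : D →ₜ* G)
  {X' Y' Z' : TopRep.{v} R D} (P' : ContPairing X' Y' Z')
  (α : TopRep.res (θ : D →* G) X ⟶ X') (β : TopRep.res (θ : D →* G) Y ⟶ Y') (γ : TopRep.res (θ : D →* G) Z ⟶ Z')
  (hc : ∀ (x : X) (y : Y), γ.hom (P.toLin x y) = P'.toLin (α.hom x) (β.hom y))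
  (U : Subgroup D) (hUN : ∀ d : D, d ∈ U → θ d ∈ N) [Fintype (G ⧸ N)] [Fintype (D ⧸ U)]
  (hbij : Function.Bijective (quotientPull N θ U hUN))

include hc hbij

omit [IsTopologicalGroup G] [IsTopologicalGroup D] in
/-- **The fibre-sum pairings correspond under `coindFinPull`** (`θ̄` bijective):
`γ(Σ_{y ∈ G⧸N} ⟨φ y, ψ y⟩) = Σ_{z ∈ D⧸U} ⟨α φ(θ̄ z), β ψ(θ̄ z)⟩'` (reindex along `θ̄`).
[cite: NeukirchSchmidtWingberg2008, I §5 Prop. (1.5.3)(iv)] -/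
theorem coindFin_toLin_pull (φ : _root_.Literature.NumberTheory.GaloisRepresentations.coindFin X N)
    (ψ : _root_.Literature.NumberTheory.GaloisRepresentations.coindFin Y N) :
    γ.hom ((P.coindFin N).toLin φ ψ) =
      (P'.coindFin U).toLin ((coindFinPull X N θ α U hUN).hom φ) ((coindFinPull Y N θ β U hUN).hom ψ) := by
  rw [coindFin_toLin_apply, coindFin_toLin_apply, map_sum, ← (Equiv.ofBijective _ hbij).sum_comp]
  exact Finset.sum_congr rfl fun z _ => by rw [Equiv.ofBijective_apply, coindFinPull_apply, coindFinPull_apply, hc]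

variable [LocallyCompactSpace G] [LocallyCompactSpace D]

/-- **`H²(θ, γ)(a ∪_{ΣP} b) = H¹(θ, coindFinPull) a ∪_{ΣP'} H¹(θ, coindFinPull) b`**: pulling back along `θ` turns the
cup product for the fibre-sum pairing over `G ⧸ N` into the one over `D ⧸ U` (`θ̄` bijective; the tree's
`cupProduct_mapPair` for the compatible pair `(θ; coindFinPull, coindFinPull, γ)`).
[cite: NeukirchSchmidtWingberg2008, I §5 Prop. (1.5.3)] -/
theorem map_cupProduct_coindFin_pull
    (a : continuousCohomology 1 (_root_.Literature.NumberTheory.GaloisRepresentations.coindFin X N))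
    (b : continuousCohomology 1 (_root_.Literature.NumberTheory.GaloisRepresentations.coindFin Y N)) :
    ContinuousCohomology.map θ γ 2 ((P.coindFin N).cupProduct a b) =
      (P'.coindFin U).cupProduct (ContinuousCohomology.map θ (coindFinPull X N θ α U hUN) 1 a)
        (ContinuousCohomology.map θ (coindFinPull Y N θ β U hUN) 1 b) :=
  cupProduct_mapPair (P.coindFin N) (P'.coindFin U) θ (coindFinPull X N θ α U hUN) (coindFinPull Y N θ β U hUN) γ
    (fun φ ψ => coindFin_toLin_pull P N θ P' α β γ hc U hUN hbij φ ψ) a b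

end ContPairing

end Literature.NumberTheory.GaloisRepresentations

end
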